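import Literature.MathematicalPhysics.QuantumFieldTheory.ConformalBootstrap3D.PointKernelK34v2Data
import Literature.MathematicalPhysics.QuantumFieldTheory.ConformalBootstrap3D.PointKernelParts

/-!
# K34v2 certificate, kernel part file P3: one-cell head segments 67, 97 in level ranges

The head cells whose kernel evaluation exceeds one `decide` are one-cell segments of `hsegsK34v2`; each is
checked by `PCert.hPartSideOK` (side conditions) and `PCert.hPartOK` per level range `[n_lo, n_lo + count)`
against an integer claim, the claims summing to `≥ 0` (`PointKernel.partsOK`); soundness is
`PCert.hParts_sound` (`PointKernelParts`).  The part files `P1, P2, …` are mutually independent (each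
imports only the data file); the ranges of one cell may span several of them, and the per-cell
conclusions `hparts_i` / `hcell_i` of those cells are assembled in `PointKernelK34v2.lean`.
Estimated kernel time 210 s.
-/

set_option maxRecDepth 100000
set_option maxHeartbeats 0

namespace Literature.MathematicalPhysics.QuantumFieldTheory.ConformalBootstrap3D.PointKernelK34v2

open Literature.MathematicalPhysics.QuantumFieldTheory.ConformalBootstrap3D.PointKernel

/-- levels `[0, 35)` of segment 67: partial lower sum `≥` claim. [folklore] -/
theorem part_67_0 : certK34v2.hPartOK (PCert.segAt hsegsK34v2 67) JHK34v2 0 35 (-12091565301372704930292834555373298) = true := by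
  decide +kernel

/-- levels `[35, 37)` of segment 67: partial lower sum `≥` claim. [folklore] -/
theorem part_67_1 : certK34v2.hPartOK (PCert.segAt hsegsK34v2 67) JHK34v2 35 2 (12091565301372704930292834555373298) = true := by
  decide +kernel

/-- one-cell segment 97 (row 4, cell `[5, 10241/2048]`, chord, `n_F = 66`,
7 level ranges): side conditions. [folklore] -/
theorem pside_97 : certK34v2.hPartSideOK (PCert.segAt hsegsK34v2 97) JHK34v2 = true := by
  decide +kernel

/-- its level ranges `(n_lo, count, claim)`. [folklore] -/
def parts_97 : List (ℕ × ℕ × ℤ) := [(0, 29, -3671538892452433460259430607798121945), (29, 12, 2699984721030383268423916764759668071), (41, 8, 632518018535497450824682374468710935), (49, 7, 229032497240093028576835302581715216), (56, 5, 74745342856770075625694615992578407), (61, 5, 37798568907133324895281776458608240), (66, 1, -2540256117443688086980226463158922)]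

/-- the ranges tile `[0, n_F]` and the claims sum to `≥ 0`. [folklore] -/
theorem pcov_97 : PointKernel.partsOK 66 parts_97 = true := by
  decide +kernel

/-- levels `[0, 29)` of segment 97: partial lower sum `≥` claim. [folklore] -/
theorem part_97_0 : certK34v2.hPartOK (PCert.segAt hsegsK34v2 97) JHK34v2 0 29 (-3671538892452433460259430607798121945) = true := by
  decide +kernel

/-- levels `[29, 41)` of segment 97: partial lower sum `≥` claim. [folklore] -/
theorem part_97_1 : certK34v2.hPartOK (PCert.segAt hsegsK34v2 97) JHK34v2 29 12 (2699984721030383268423916764759668071) = true := by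
  decide +kernel

end Literature.MathematicalPhysics.QuantumFieldTheory.ConformalBootstrap3D.PointKernelK34v2
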